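import Literature.AlgebraicGeometry.Hironaka2017.Lib.MonomialComponentCount
import Literature.AlgebraicGeometry.Resolution.MarkedIdeals
import Literature.AlgebraicGeometry.Resolution.MarkedIdealsArithmetic
import Literature.AlgebraicGeometry.Resolution.StalkIdealLemmas
import Mathlib.RingTheory.Ideal.KrullsHeightTheorem
import HarnessLib

/-!
# Crux `PatchingRelPerfect` (stmt-ResolutionOfSingularities-16161), chain W5.2 — F7(β) (β-AX) X3 C-I (M2b) cure §1b, LOCAL ALGEBRA: the two
# stalk lemmas behind «no component of the contact surface lies in the boundary»

[OURS · L1 W5.2 · cure plan of record (res-L1-w52-lead-1 g6, 22:35Z).]  Replaces the role of NO printed item; NOT a statement of the manuscript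
under review (AI-written; AI review weaker than expert review; counted 0).  Def-free, fact-free.

* `ringKrullDim_stalk_le_two_of_mem_maxPoints` — at a MAXIMAL POINT `η` of `Supp (V ⊔ Φ)` with `V_η = (v)`, `Φ_η = (φ)` principal, the local
  ring has dimension `≤ 2` (`𝔪_η` is minimal over the 2-generated ideal `(v, φ)`: Krull΄s height theorem).
* `stalkIdeal_sup_eq_maximalIdeal_of_hasSNC` — two members of a simple normal crossings family through `x` with DIFFERENT stalks span the
  maximal ideal as soon as `dim 𝒪_{X,x} ≤ 2` (they are two distinct members of one regular system of parameters, and there are only two).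

## References
* H. Matsumura, *Commutative Ring Theory* (1987), Thm. 13.5 (Krull), Thm. 14.2. [Matsumura1987]
* E. Bierstone, D. Grigoriev, P. Milman, J. Włodarczyk, arXiv:1206.3090, Def. 3.1.1. [BierstoneGrigorievMilmanWlodarczyk2011]
-/

-- `Summit.<Summit>.<Sub>.Theorems` with `Sub = Summit` (single-conjunct summit, D-0017)
set_option linter.dupNamespace false

noncomputable section

namespace Summit.ResolutionOfSingularities.ResolutionOfSingularities.Theorems.X3LemmaM

open CategoryTheory AlgebraicGeometry TopologicalSpace IsLocalRing
open Literature.AlgebraicGeometry.Resolution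
open Literature.AlgebraicGeometry.Hironaka2017.MonomialComponent
open Scheme.IdealSheafData

universe u

variable {X : Scheme.{u}}

/-- [OURS · L1 W5.2 · cure §1b] **KRULL AT A MAXIMAL POINT OF `Supp (V ⊔ Φ)`**: if `η` is a maximal point of the support of `V ⊔ Φ` and both stalks
at `η` are principal, then `dim 𝒪_{X,η} ≤ 2`. [cite: Matsumura1987, Thm. 13.5] -/
theorem ringKrullDim_stalk_le_two_of_mem_maxPoints [IsLocallyNoetherian X] {V Φ : X.IdealSheafData} {η : X}
    (hη : η ∈ maxPoints (((V ⊔ Φ).support : Set X))) {v φ : X.presheaf.stalk η}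
    (hV : stalkIdeal V η = Ideal.span {v}) (hΦ : stalkIdeal Φ η = Ideal.span {φ}) :
    ringKrullDim (X.presheaf.stalk η) ≤ 2 := by
  have hmin := maximalIdeal_mem_minimalPrimes_of_mem_maxPoints hη
  rw [stalkIdeal_sup, hV, hΦ, ← Ideal.span_insert] at hmin
  have hfin : ({v, φ} : Set (X.presheaf.stalk η)).Finite := Set.toFinite _
  have h2 := Ideal.height_le_card_of_mem_minimalPrimes_span hfin hmin
  have hcard : ({v, φ} : Set (X.presheaf.stalk η)).ncard ≤ 2 :=
    (Set.ncard_insert_le v {φ}).trans (by rw [Set.ncard_singleton])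
  have h3 : (maximalIdeal (X.presheaf.stalk η)).height ≤ 2 := h2.trans (by exact_mod_cast hcard)
  have h4 : ((maximalIdeal (X.presheaf.stalk η)).height : WithBot ℕ∞) ≤ ((2 : ℕ∞) : WithBot ℕ∞) := WithBot.coe_le_coe.mpr h3
  rwa [IsLocalRing.maximalIdeal_height_eq_ringKrullDim] at h4

/-- [OURS · L1 W5.2 · cure §1b] **TWO SNC MEMBERS WITH DIFFERENT STALKS SPAN `𝔪` IN DIMENSION `≤ 2`.** [cite: Matsumura1987, Thm. 14.2]
[cite: BierstoneGrigorievMilmanWlodarczyk2011, Def. 3.1.1] -/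
theorem stalkIdeal_sup_eq_maximalIdeal_of_hasSNC {E : List X.IdealSheafData} (hE : HasSNC E) {D₁ D₂ : X.IdealSheafData}
    (h₁ : D₁ ∈ E) (h₂ : D₂ ∈ E) {x : X} (hx₁ : x ∈ (D₁.support : Set X)) (hx₂ : x ∈ (D₂.support : Set X))
    (hne : stalkIdeal D₁ x ≠ stalkIdeal D₂ x) (hdim : ringKrullDim (X.presheaf.stalk x) ≤ 2) :
    stalkIdeal D₁ x ⊔ stalkIdeal D₂ x = maximalIdeal (X.presheaf.stalk x) := by
  obtain ⟨hreg, u, hu, ⟨ι, hι, hιu⟩, -⟩ := hE x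
  haveI := hreg
  set i := ι ⟨D₁, h₁, hx₁⟩ with hi
  set j := ι ⟨D₂, h₂, hx₂⟩ with hj
  have hij : i ≠ j := by
    intro h
    apply hne
    rw [hιu ⟨D₁, h₁, hx₁⟩, hιu ⟨D₂, h₂, hx₂⟩, ← hi, ← hj, h]
  -- the regular system has exactly two members
  have hd : (maximalIdeal (X.presheaf.stalk x)).spanFinrank = 2 := by
    have hle : ((maximalIdeal (X.presheaf.stalk x)).spanFinrank : WithBot ℕ∞) ≤ 2 := by
      rw [IsRegularLocalRing.spanFinrank_maximalIdeal]; exact hdim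
    have hge : 2 ≤ (maximalIdeal (X.presheaf.stalk x)).spanFinrank := Fin.nontrivial_iff_two_le.mp (nontrivial_of_ne i j hij)
    have hle' : (maximalIdeal (X.presheaf.stalk x)).spanFinrank ≤ 2 := by exact_mod_cast hle
    omega
  -- hence `{i, j}` is everything and `(u i, u j) = 𝔪`
  have huniv : ∀ k, k = i ∨ k = j := by
    intro k
    by_contra hk
    rw [not_or] at hk
    have h3 : Finset.card ({i, j, k} : Finset (Fin _)) = 3 :=
      Finset.card_eq_three.mpr ⟨i, j, k, hij, fun h => hk.1 h.symm, fun h => hk.2 h.symm, rfl⟩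
    have h4 := Finset.card_le_univ ({i, j, k} : Finset (Fin _))
    rw [h3, Fintype.card_fin] at h4
    omega
  have hrange : Set.range u = {u i, u j} := by
    ext a
    simp only [Set.mem_range, Set.mem_insert_iff, Set.mem_singleton_iff]
    constructor
    · rintro ⟨k, rfl⟩
      rcases huniv k with rfl | rfl
      · exact Or.inl rfl
      · exact Or.inr rfl
    · rintro (rfl | rfl)
      · exact ⟨i, rfl⟩
      · exact ⟨j, rfl⟩
  rw [hιu ⟨D₁, h₁, hx₁⟩, hιu ⟨D₂, h₂, hx₂⟩, ← hi, ← hj, ← Ideal.span_insert, ← hrange, hu]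

end Summit.ResolutionOfSingularities.ResolutionOfSingularities.Theorems.X3LemmaM

end
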